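import Literature.Analysis.FluidPDE.LerayLocalRegularH1
import Literature.Analysis.FluidPDE.TaoLocalisationProofs
import Literature.Analysis.FluidPDE.TaoH1AlmostRegularAssembly
import Literature.Analysis.FluidPDE.CheskidovShvydkoyRegularProofs
import Literature.Analysis.FluidPDE.TaoFiniteEnergyLerayHopf
import Literature.Analysis.FluidPDE.TaoClassGlobal
import Literature.Analysis.FluidPDE.LerayHopfRestartEverywhere
import Literature.Analysis.FluidPDE.LerayHopfNSRescale
import Literature.Analysis.FluidPDE.ClassicalSolutionRescale
import Literature.Analysis.FunctionSpaces.HolderInterpolation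
import HarnessLib

/-!
# Leray's local regular solutions from `H¹` data: proofs

Analysis/FluidPDE proof file (no named facts) for the discharge of
`Literature.Analysis.FluidPDE.leray_local_regular_H1` (`LerayLocalRegularH1.lean`; Leray 1934,
Ch. III §§19–24; Ożański–Pooley 2018, Thm. 6.30, Cor. 6.16, Lemma 6.29; Robinson–Rodrigo–Sadowski
2016, Thm. 6.15) from the tree's local `H¹` theory of Tao 2013, Thm. 5.4 / Prop. 5.6
(`tao2011_H1_local_almost_regular`, `TaoH1AlmostRegular.lean`, itself reduced in the tree to the
smooth local theory by `tao2011_H1_local_almost_regular_of_smooth_local_existence`, and the latter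
to the Fourier-side construction by `tao2011_smooth_local_existence_of_fourier`). Main results:

* `exists_regular_of_taoH1AlmostRegularWith` — from `TaoH1AlmostRegularWith c`, the local
  Leray–Hopf solution from `u₀ ∈ H¹` (smallness in the full `H¹` norm) can be taken to be
  *itself* a classical solution on `(0, T]` with all the bounds of Leray's package on every
  `[δ, T]`, `δ > 0`, and `L²`-continuous on `[0, T]`;
* `lerayLocalRegularH1With_of_taoH1AlmostRegularWith` —
  `TaoH1AlmostRegularWith c → LerayLocalRegularH1With (c/4)`: the lifespan in terms of `‖∇u₀‖`
  alone, by the Navier–Stokes scaling `u₀ ↦ λu₀(λ ·)` (Leray 1934, §20), using the covariance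
  of Leray–Hopf solutions proved in `LerayHopfNSRescale.lean`;
* `leray_local_regular_H1_of_tao2011_H1_local_almost_regular`,
  `leray_local_regular_H1_of_tao2011_smooth_local_existence`, and the **discharge**
  `leray_local_regular_H1_holds`, from the tree's `tao2011_H1_local_almost_regular_holds`
  (`CheskidovShvydkoyRegularProofs.lean`).

The glue, in order of appearance:

* `IsLerayHopfOn.congr_ae_slices` — a Leray–Hopf weak solution stays Leray–Hopf (same datum) when
  every time slice is changed on a null set of space (all clauses see the slices through
  integrals; the joint measurability of the new field is a hypothesis);
* `IsClassicalNSSolutionOn.exists_glue_Ioc_of_memLp` — gluing classical solutions on nested final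
  segments `(sₙ, T]` whose velocities agree on overlaps and whose pressures are square integrable:
  then the pressures agree too (the momentum equations give `∇p₁ = ∇p₂`, a constant difference,
  which is `0` in `L²(ℝ³)`), so the glued pair keeps the given `L²` pressures — the variant of the
  tree's `IsClassicalNSSolutionOn.exists_glue_Ioc` (which normalises `p(t, 0) = 0`);
* `exists_forall_norm_iteratedFDeriv_le_of_hasBoundedSobolevNormsOn` — all derivatives of a field
  with bounded `L²` Sobolev norms of all orders are bounded (`H² ⊂ C_B` applied to `Dⁿu`);
* `continuousInLpOn_Icc_of_classical`, `ContinuousInLpOn.continuousOn_eEnergy`,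
  `IsH1RegularOn.continuousOn_eWeakGradL2Sq` — `L²` continuity of classical finite energy pieces
  and continuity of energy and weak dissipation separately (needed because the two scale
  differently); `eWeakGradL2Sq_nsRescaleData`, `eEnergy_nsRescaleData_three`,
  `eWeakGradL2Sq_nsRescaleData_three`, `lintegral_iteratedFDeriv_dilate_sq_le` — the scaling laws.

## Mathlib / tree search

Tree: `TaoH1AlmostRegularWith`, `tao2011_H1_local_almost_regular_of_smooth_local_existence`,
`tao2011_H1_local_almost_regular_holds` (`CheskidovShvydkoyRegularProofs.lean`); the tree's
`leray_local_strong_H1_holds` (`LerayH1ContinuationProofs.lean`, the weaker package without the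
smoothing clauses) obtains the gradient lifespan by re-running the smooth theory with the enstrophy
a priori bound instead of by scaling;
`IsClassicalNSSolutionOn.exists_glue_Ioc`, `pressure_sub_apply_zero_eq_of_timeDerivWithin_eq`,
`timeDerivWithin_Ioc_eq_of_eqOn` (`CheskidovShvydkoyRegular.lean`); `isLerayHopfOn_of_finiteEnergy`
(`TaoFiniteEnergyLerayHopf.lean`); `IsClassicalNSSolutionOn.congr_slices` (`TaoClassGlobal.lean`),
`ContinuousInLpOn.comp_add_right`, `ContinuousInLpOn.congr_eqOn` (`TaoClassGlue.lean`),
`ContinuousInLpOn.tendsto_kineticEnergy` (`LerayHopfRestartEverywhere.lean`);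
`FunctionSpaces.exists_enorm_le_sobolev_two_two_dim_three` (`SobolevImbeddingSup.lean`),
`eLpNorm_two_le_rpow_of_lintegral_sq_le` (`TaoLocalisationProofs.lean`),
`FunctionSpaces.norm_iteratedFDeriv_rescale_le` (`HolderInterpolation.lean`);
`isLerayHopfOn_nsRescale`, `eEnergy_nsRescaleData`, `hasWeakGradient_nsRescaleData`,
`memLp_nsRescaleData` (`LerayHopfNSRescale.lean`); `IsClassicalNSSolutionOn.nsRescale_holds`,
`timeDerivWithin_smul_stPull` (`ClassicalSolutionRescale.lean`). The private
`norm_iteratedFDeriv_iteratedFDeriv_aux` and `cmm_norm_le_sum_norm_apply_basis` repeat two lemmas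
of `CheskidovShvydkoyAssembly.lean` (a consumer of `leray_local_regular_H1`, not importable here
without inverting the dependency).

## References

* J. Leray, Acta Math. 63 (1934), Ch. III §§19–24, §20 (scaling). [Leray1934]
* T. Tao, Anal. PDE 6 (2013) 25–107 = arXiv:1108.1165, Thm. 5.4, Prop. 5.6, Lemma 8.1. [Tao2011]
* W. S. Ożański, B. C. Pooley, in: LMS Lecture Notes 452 (2018), Thm. 6.30, Cor. 6.16,
  Lemma 6.29. [OzanskiPooley2018]
* J. C. Robinson, J. L. Rodrigo, W. Sadowski, CUP 2016, Thm. 6.15. [RobinsonRodrigoSadowski2016]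
* R. A. Adams, *Sobolev Spaces* (1975), Thm. 5.4 Part I Case C. [Adams1975]
-/

noncomputable section

open MeasureTheory TopologicalSpace Set Function Filter
open _root_.Topology
open scoped InnerProductSpace RealInnerProductSpace ENNReal NNReal ContDiff Laplacian

namespace Literature.Analysis.FluidPDE

/-! ## Leray–Hopf solutions under slice-wise a.e. modification -/

section CongrSlices

variable {E : Type*} [NormedAddCommGroup E] [InnerProductSpace ℝ E] [FiniteDimensional ℝ E]
  [MeasurableSpace E] [BorelSpace E]

/-- Lower integrals over a product strip `(0, T) × K` of two (a.e.-)measurable integrands whose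
slices agree a.e. for every `t ∈ (0, T)` are equal (Tonelli). [folklore] -/
theorem setLIntegral_prod_congr_of_ae_slice {T : ℝ} {K : Set E} {F G : ℝ × E → ℝ≥0∞}
    (hF : AEMeasurable F (volume.restrict (Ioo 0 T ×ˢ K)))
    (hG : AEMeasurable G (volume.restrict (Ioo 0 T ×ˢ K)))
    (h : ∀ t ∈ Ioo 0 T, (fun x => F (t, x)) =ᵐ[volume.restrict K] fun x => G (t, x)) :
    ∫⁻ z in Ioo 0 T ×ˢ K, F z = ∫⁻ z in Ioo 0 T ×ˢ K, G z := by
  have hμ : ((volume : Measure (ℝ × E)).restrict (Ioo 0 T ×ˢ K)) =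
      (volume.restrict (Ioo 0 T)).prod (volume.restrict K) := by
    rw [Measure.volume_eq_prod, Measure.prod_restrict]
  rw [hμ] at hF hG ⊢
  rw [lintegral_prod _ hF, lintegral_prod _ hG]
  refine setLIntegral_congr_fun measurableSet_Ioo fun t ht => ?_
  exact lintegral_congr_ae (h t ht)

/-- **Leray–Hopf solutions under slice-wise a.e. modification.** Let `u` be a Leray–Hopf weak
solution of the unforced system on `E × [0, T)`, `T > 0`, from `u₀`, and let `v` be jointly
(a.e. strongly) measurable on `(0, T) × E` with `v(t) = u(t)` a.e. in space for every `t ∈ [0, T]`.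
Then `v` is a Leray–Hopf weak solution from `u₀`: every clause of the definition sees the slices
only through spatial integrals (weak formulation, energies, pairings, `L²` distances) or through
a.e.-stable notions (weak gradients, weak divergence-freeness, `L²` membership). [folklore] -/
theorem IsLerayHopfOn.congr_ae_slices {T ν : ℝ} {u₀ : E → E} {u v : ℝ → E → E}
    (hu : IsLerayHopfOn T ν 0 u₀ u) (hT : 0 < T)
    (hvm : AEStronglyMeasurable (uncurry v) (volume.restrict (Ioo 0 T ×ˢ univ)))
    (hv : ∀ t ∈ Icc 0 T, v t =ᵐ[volume] u t) : IsLerayHopfOn T ν 0 u₀ v := by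
  have hIoo : ∀ t ∈ Ioo 0 T, v t =ᵐ[volume] u t := fun t ht => hv t (Ioo_subset_Icc_self ht)
  have hpair : ∀ t ∈ Icc 0 T, ∀ w : E → E, ∫ x, ⟪v t x, w x⟫ = ∫ x, ⟪u t x, w x⟫ :=
    fun t ht w => integral_congr_ae ((hv t ht).mono fun x hx => by simp only [hx])
  obtain ⟨hmeas, hloc, hdiv, hweak⟩ := hu.weak
  refine
    { weak := ⟨hvm, fun K hK => ?_, ?_, fun ψ hψ hψdiv => ?_⟩
      energy_bound := ?_
      memLp := fun t ht => (hu.memLp t ht).ae_eq (hv t ht).symm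
      weakGrad_energy := ?_
      weak_continuous := fun w hw => ?_
      strong_initial := ?_ }
  · -- local square integrability
    have hle : volume.restrict (Ioo 0 T ×ˢ K) ≤ (volume : Measure (ℝ × E)).restrict (Ioo 0 T ×ˢ univ) :=
      Measure.restrict_mono (prod_mono Subset.rfl (subset_univ K)) le_rfl
    have hvm' : AEMeasurable (fun z => ‖uncurry v z‖ₑ ^ 2) (volume.restrict (Ioo 0 T ×ˢ K)) :=
      ((hvm.mono_measure hle).enorm.pow_const 2)
    have hum' : AEMeasurable (fun z => ‖uncurry u z‖ₑ ^ 2) (volume.restrict (Ioo 0 T ×ˢ K)) :=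
      ((hmeas.mono_measure hle).enorm.pow_const 2)
    rw [setLIntegral_prod_congr_of_ae_slice hvm' hum' fun t ht =>
      (ae_restrict_of_ae (hIoo t ht)).mono fun x hx => by simp only [uncurry_apply_pair, hx]]
    exact hloc K hK
  · -- weak divergence-freeness of a.e. slice
    filter_upwards [hdiv, ae_restrict_mem measurableSet_Ioo] with t ht htI
    intro θ hθ
    rw [← ht θ hθ]
    exact integral_congr_ae ((hIoo t htI).mono fun x hx => by simp only [hx])
  · -- the weak identity
    have key : ∫ t in Ioo 0 T, ∫ x, (⟪v t x, timeDeriv ψ t x⟫ + ⟪v t x, convect (v t) (ψ t) x⟫ +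
        ν * ⟪v t x, Δ (ψ t) x⟫ + ⟪(0 : ℝ → E → E) t x, ψ t x⟫) =
        ∫ t in Ioo 0 T, ∫ x, (⟪u t x, timeDeriv ψ t x⟫ + ⟪u t x, convect (u t) (ψ t) x⟫ +
        ν * ⟪u t x, Δ (ψ t) x⟫ + ⟪(0 : ℝ → E → E) t x, ψ t x⟫) :=
      setIntegral_congr_fun measurableSet_Ioo fun t ht =>
        integral_congr_ae ((hIoo t ht).mono fun x hx => by simp only [convect_apply, hx])
    rw [key]
    exact hweak ψ hψ hψdiv
  · -- `L^∞(0, T; L²)`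
    obtain ⟨C, hC⟩ := hu.energy_bound
    refine ⟨C, ?_⟩
    filter_upwards [hC, ae_restrict_mem measurableSet_Ioo] with t ht htI
    rwa [eEnergy_congr_ae (hIoo t htI)]
  · -- weak gradient and the two energy inequalities
    obtain ⟨G, hG, hGint, h0, hae⟩ := hu.weakGrad_energy
    refine ⟨G, ?_, hGint, fun t ht => ?_, ?_⟩
    · filter_upwards [hG, ae_restrict_mem measurableSet_Ioo] with t ht htI
      exact ht.congr_ae (hIoo t htI)
    · have h1 := h0 t ht
      simp only [Pi.zero_apply, inner_zero_left, integral_zero, intervalIntegral.integral_zero,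
        add_zero] at h1 ⊢
      rwa [kineticEnergy_congr_ae (hv t ht)]
    · filter_upwards [hae, ae_restrict_mem measurableSet_Ioo] with s hs hsI t hst
      have h1 := hs t hst
      simp only [Pi.zero_apply, inner_zero_left, integral_zero, intervalIntegral.integral_zero,
        add_zero] at h1 ⊢
      rwa [kineticEnergy_congr_ae (hv t ⟨hsI.1.le.trans hst.1, hst.2⟩),
        kineticEnergy_congr_ae (hv s ⟨hsI.1.le, hsI.2.le⟩)]
  · -- weak `L²` continuity and the weak initial limit
    obtain ⟨hcont, hlim⟩ := hu.weak_continuous w hw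
    refine ⟨hcont.congr fun t ht => hpair t ⟨ht.1.le, ht.2⟩ w, hlim.congr' ?_⟩
    filter_upwards [Ioo_mem_nhdsGT hT] with t ht
    exact (hpair t (Ioo_subset_Icc_self ht) w).symm
  · -- strong attainment of the datum
    refine hu.strong_initial.congr' ?_
    filter_upwards [Ioo_mem_nhdsGT hT] with t ht
    exact (eLpNorm_congr_ae ((hIoo t ht).mono fun x hx => by simp only [Pi.sub_apply, hx])).symm

end CongrSlices

/-! ## Gluing classical solutions on nested final segments, keeping `L²` pressures -/

section Glue

variable {E : Type*} [NormedAddCommGroup E] [InnerProductSpace ℝ E] [FiniteDimensional ℝ E]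
  [MeasurableSpace E] [BorelSpace E]
variable {ν : ℝ}

/-- **Square-integrable pressures are determined by the velocity.** If two classical solutions
(same `ν`, same force) on time sets `S₁ ∋ t`, `S₂ ∋ t` have the same velocity slice and the same
one-sided time derivative at time `t`, and both pressure slices are in `L²(E)` (`E ≠ 0`), then the
pressure slices coincide: by `pressure_sub_apply_zero_eq_of_timeDerivWithin_eq` they differ by the
constant `p₁(t,0) - p₂(t,0)`, an `L²` function on a space of infinite volume, hence `0`. [folklore] -/
theorem IsClassicalNSSolutionOn.pressure_eq_of_timeDerivWithin_eq_of_memLp [Nontrivial E]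
    {S₁ S₂ : Set ℝ} {f u₁ u₂ : ℝ → E → E} {p₁ p₂ : ℝ → E → ℝ}
    (h₁ : IsClassicalNSSolutionOn S₁ ν f u₁ p₁) (h₂ : IsClassicalNSSolutionOn S₂ ν f u₂ p₂) {t : ℝ}
    (ht₁ : t ∈ S₁) (ht₂ : t ∈ S₂) (hu : u₁ t = u₂ t)
    (hdt : ∀ x, timeDerivWithin S₁ u₁ t x = timeDerivWithin S₂ u₂ t x)
    (hp₁ : MemLp (p₁ t) 2 volume) (hp₂ : MemLp (p₂ t) 2 volume) : p₁ t = p₂ t := by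
  have hsub := h₁.pressure_sub_apply_zero_eq_of_timeDerivWithin_eq h₂ ht₁ ht₂ hu hdt
  set c : ℝ := p₁ t 0 - p₂ t 0 with hc
  have hconst : (fun x => p₁ t x - p₂ t x) = fun _ => c := by
    funext x
    have := hsub x
    rw [hc]
    linarith
  have hmem : MemLp (fun _ : E => c) 2 volume := by
    rw [← hconst]
    exact hp₁.sub hp₂
  have hc0 : c = 0 := by
    rcases (memLp_const_iff two_ne_zero ENNReal.ofNat_ne_top).1 hmem with h | h
    · exact h
    · exact absurd h (by simp)
  funext x
  have := congrFun hconst x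
  rw [hc0] at this
  linarith

/-- **Gluing classical solutions on nested final segments, keeping the pressures.** Let
`(V n, P n)` be classical solutions (same `ν`, same force) on the time sets `(s n, T]`,
`0 < s n`, with `s n` becoming arbitrarily small, whose velocities agree on the common part of
any two of the time sets and whose pressure slices are square integrable. Then there is a
classical solution `(v, p)` on `(0, T]` with `v = V n` **and `p = P n`** on `(s n, T]` for every
`n`: velocities agree by hypothesis, pressures by `pressure_eq_of_timeDerivWithin_eq_of_memLp`
(the one-sided time derivatives within the pieces agree, `timeDerivWithin_Ioc_eq_of_eqOn`);
smoothness is local and the time derivative within `(0, T]` at `t > s n` is that within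
`(s n, T]`. Variant of the tree's `IsClassicalNSSolutionOn.exists_glue_Ioc`, which instead
normalises the pressure by `p(t, 0) = 0`. [folklore] -/
theorem IsClassicalNSSolutionOn.exists_glue_Ioc_of_memLp [Nontrivial E] {T : ℝ} {f : ℝ → E → E}
    {s : ℕ → ℝ} {V : ℕ → ℝ → E → E} {P : ℕ → ℝ → E → ℝ} (hs0 : ∀ n, 0 < s n)
    (hs : ∀ t, 0 < t → ∃ n, s n < t)
    (hV : ∀ n, IsClassicalNSSolutionOn (Ioc (s n) T) ν f (V n) (P n))
    (hagree : ∀ m n, ∀ t ∈ Ioc (max (s m) (s n)) T, V m t = V n t)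
    (hP : ∀ n, ∀ t ∈ Ioc (s n) T, MemLp (P n t) 2 volume) :
    ∃ (v : ℝ → E → E) (p : ℝ → E → ℝ), IsClassicalNSSolutionOn (Ioc 0 T) ν f v p ∧
      (∀ n, ∀ t ∈ Ioc (s n) T, v t = V n t) ∧ ∀ n, ∀ t ∈ Ioc (s n) T, p t = P n t := by
  classical
  -- the index of a piece containing `t`
  set N : ℝ → ℕ := fun t => if h : ∃ n, s n < t then Nat.find h else 0 with hN_def
  have hN : ∀ t, 0 < t → s (N t) < t := by
    intro t ht
    have h := hs t ht
    simp only [hN_def, dif_pos h]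
    exact Nat.find_spec h
  set v : ℝ → E → E := fun t => V (N t) t with hv_def
  set p : ℝ → E → ℝ := fun t => P (N t) t with hp_def
  -- on the piece `(s n, T]` the glued fields are those of the piece `n`
  have hvn : ∀ n, ∀ t ∈ Ioc (s n) T, v t = V n t := by
    intro n t ht
    have ht0 : 0 < t := (hs0 n).trans ht.1
    exact hagree (N t) n t ⟨max_lt (hN t ht0) ht.1, ht.2⟩
  have hdtn : ∀ m n, ∀ t ∈ Ioc (max (s m) (s n)) T, ∀ x,
      timeDerivWithin (Ioc (s m) T) (V m) t x = timeDerivWithin (Ioc (s n) T) (V n) t x := by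
    intro m n t ht x
    have h1 : timeDerivWithin (Ioc (s m) T) (V m) t x =
        timeDerivWithin (Ioc (max (s m) (s n)) T) (V n) t x :=
      timeDerivWithin_Ioc_eq_of_eqOn (le_max_left _ _) ht.1 (fun τ hτ => hagree m n τ hτ) ht.2 x
    have h2 : timeDerivWithin (Ioc (s n) T) (V n) t x =
        timeDerivWithin (Ioc (max (s m) (s n)) T) (V n) t x :=
      timeDerivWithin_Ioc_eq_of_eqOn (le_max_right _ _) ht.1 (fun τ _ => rfl) ht.2 x
    rw [h1, h2]
  have hPmn : ∀ m n, ∀ t ∈ Ioc (max (s m) (s n)) T, P m t = P n t := by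
    intro m n t ht
    have htm : t ∈ Ioc (s m) T := ⟨(le_max_left _ _).trans_lt ht.1, ht.2⟩
    have htn : t ∈ Ioc (s n) T := ⟨(le_max_right _ _).trans_lt ht.1, ht.2⟩
    exact (hV m).pressure_eq_of_timeDerivWithin_eq_of_memLp (hV n) htm htn (hagree m n t ht)
      (hdtn m n t ht) (hP m t htm) (hP n t htn)
  have hpn : ∀ n, ∀ t ∈ Ioc (s n) T, p t = P n t := by
    intro n t ht
    have ht0 : 0 < t := (hs0 n).trans ht.1
    exact hPmn (N t) n t ⟨max_lt (hN t ht0) ht.1, ht.2⟩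
  -- the time derivative within `(0, T]` is that within the piece
  have hdt0 : ∀ n, ∀ t ∈ Ioc (s n) T, ∀ x,
      timeDerivWithin (Ioc 0 T) v t x = timeDerivWithin (Ioc (s n) T) (V n) t x := fun n t ht x =>
    timeDerivWithin_Ioc_eq_of_eqOn (hs0 n).le ht.1 (hvn n) ht.2 x
  -- relative openness of the pieces
  have hpiece : ∀ n, Ioc 0 T ×ˢ (univ : Set E) ∩ Ioi (s n) ×ˢ univ = Ioc (s n) T ×ˢ univ := by
    intro n
    ext ⟨t, x⟩
    simp only [mem_inter_iff, mem_prod, mem_Ioc, mem_univ, and_true, mem_Ioi]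
    constructor
    · rintro ⟨⟨-, h2⟩, h3⟩; exact ⟨h3, h2⟩
    · rintro ⟨h1, h2⟩; exact ⟨⟨(hs0 n).trans h1, h2⟩, h1⟩
  have hsmooth : ∀ (w : ℝ → E → ℝ) (W : ℕ → ℝ → E → ℝ),
      (∀ n, IsSmoothSpaceTimeOn (Ioc (s n) T) (W n)) →
      (∀ n, ∀ t ∈ Ioc (s n) T, w t = W n t) → IsSmoothSpaceTimeOn (Ioc 0 T) w := by
    intro w W hW hwW
    refine contDiffOn_of_locally_contDiffOn fun z hz => ?_
    obtain ⟨n, hn⟩ := hs z.1 hz.1.1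
    refine ⟨Ioi (s n) ×ˢ univ, isOpen_Ioi.prod isOpen_univ, ⟨hn, mem_univ _⟩, ?_⟩
    rw [hpiece n]
    exact (hW n).congr fun z' hz' => by
      show w z'.1 z'.2 = W n z'.1 z'.2
      rw [hwW n z'.1 hz'.1]
  have hsmoothE : ∀ (w : ℝ → E → E) (W : ℕ → ℝ → E → E),
      (∀ n, IsSmoothSpaceTimeOn (Ioc (s n) T) (W n)) →
      (∀ n, ∀ t ∈ Ioc (s n) T, w t = W n t) → IsSmoothSpaceTimeOn (Ioc 0 T) w := by
    intro w W hW hwW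
    refine contDiffOn_of_locally_contDiffOn fun z hz => ?_
    obtain ⟨n, hn⟩ := hs z.1 hz.1.1
    refine ⟨Ioi (s n) ×ˢ univ, isOpen_Ioi.prod isOpen_univ, ⟨hn, mem_univ _⟩, ?_⟩
    rw [hpiece n]
    exact (hW n).congr fun z' hz' => by
      show w z'.1 z'.2 = W n z'.1 z'.2
      rw [hwW n z'.1 hz'.1]
  refine ⟨v, p, ⟨?_, ?_, ?_, ?_⟩, hvn, hpn⟩
  · exact hsmoothE v V (fun n => (hV n).smooth_velocity) hvn
  · exact hsmooth p P (fun n => (hV n).smooth_pressure) hpn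
  · intro t ht x
    obtain ⟨n, hn⟩ := hs t ht.1
    have htn : t ∈ Ioc (s n) T := ⟨hn, ht.2⟩
    rw [hdt0 n t htn x, hvn n t htn, hpn n t htn]
    exact (hV n).momentum t htn x
  · intro t ht
    obtain ⟨n, hn⟩ := hs t ht.1
    rw [hvn n t ⟨hn, ht.2⟩]
    exact (hV n).divFree t ⟨hn, ht.2⟩

end Glue

/-! ## All derivatives of a field with bounded Sobolev norms are bounded -/

section SupBounds

/-- Local notation for physical space `ℝ³ = EuclideanSpace ℝ (Fin 3)`. -/
local notation "ℝ³" => EuclideanSpace ℝ (Fin 3)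

/-- `‖D^j (D^n f)(x)‖ = ‖D^{n+j} f(x)‖` (induction on `n` through `iteratedFDeriv_succ_eq_comp_right`,
the curry isometries and `norm_iteratedFDeriv_fderiv`; domain and codomain in one universe so that
the induction can pass to `Df`; same statement as the tree's `norm_iteratedFDeriv_iteratedFDeriv`
of `CheskidovShvydkoyAssembly.lean`, kept private here to avoid importing that assembly). [folklore] -/
private theorem norm_iteratedFDeriv_iteratedFDeriv_aux {X : Type} [NormedAddCommGroup X]
    [NormedSpace ℝ X] :
    ∀ {Y : Type} [NormedAddCommGroup Y] [NormedSpace ℝ Y] {f : X → Y} (n j : ℕ) (x : X),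
    ‖iteratedFDeriv ℝ j (iteratedFDeriv ℝ n f) x‖ = ‖iteratedFDeriv ℝ (n + j) f x‖ := by
  intro Y _ _ f n
  induction n generalizing Y with
  | zero =>
    intro j x
    rw [zero_add, iteratedFDeriv_zero_eq_comp]
    exact LinearIsometryEquiv.norm_iteratedFDeriv_comp_left
      (continuousMultilinearCurryFin0 ℝ X Y).symm f x j
  | succ n ih =>
    intro j x
    have hrep : iteratedFDeriv ℝ (n + 1) f =
        (continuousMultilinearCurryRightEquiv' ℝ n X Y).symm ∘
          iteratedFDeriv ℝ n (fun y => fderiv ℝ f y) := by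
      funext y; exact iteratedFDeriv_succ_eq_comp_right
    rw [hrep]
    have h1 := LinearIsometryEquiv.norm_iteratedFDeriv_comp_left
      (continuousMultilinearCurryRightEquiv' ℝ n X Y).symm
      (iteratedFDeriv ℝ n (fun y => fderiv ℝ f y)) x j
    rw [h1, ih j x, Nat.add_right_comm]
    exact norm_iteratedFDeriv_fderiv

/-- **The norm of a multilinear map is controlled by its values on an orthonormal basis**:
`‖M‖ ≤ ∑_σ ‖M(b_{σ(1)}, …, b_{σ(n)})‖` (same statement as
`ContinuousMultilinearMap.norm_le_sum_norm_apply_basis` of `CheskidovShvydkoyAssembly.lean`). [folklore] -/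
private theorem cmm_norm_le_sum_norm_apply_basis {X : Type*} [NormedAddCommGroup X]
    [InnerProductSpace ℝ X] {κ : Type*} [Fintype κ] {F : Type*} [NormedAddCommGroup F]
    [NormedSpace ℝ F] {n : ℕ} (b : OrthonormalBasis κ ℝ X)
    (M : ContinuousMultilinearMap ℝ (fun _ : Fin n => X) F) :
    ‖M‖ ≤ ∑ σ : Fin n → κ, ‖M (fun i => b (σ i))‖ := by
  classical
  refine M.opNorm_le_bound (Finset.sum_nonneg fun σ _ => norm_nonneg _) fun y => ?_
  have hy : y = fun i => ∑ k, ⟪b k, y i⟫ • b k := funext fun i => (b.sum_repr' (y i)).symm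
  conv_lhs => rw [hy]
  rw [ContinuousMultilinearMap.map_sum M (fun i k => ⟪b k, y i⟫ • b k)]
  refine (norm_sum_le _ _).trans ?_
  rw [Finset.sum_mul]
  refine Finset.sum_le_sum fun σ _ => ?_
  rw [ContinuousMultilinearMap.map_smul_univ, norm_smul, mul_comm]
  gcongr
  rw [Real.norm_eq_abs, Finset.abs_prod]
  exact Finset.prod_le_prod (fun i _ => abs_nonneg _) fun i _ =>
    (abs_real_inner_le_norm _ _).trans (by rw [b.orthonormal.1, one_mul])

/-- **All derivatives are bounded in the strong class.** If the slices `u t`, `t ∈ S`, are smooth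
and all `L²` Sobolev seminorms of `u` are bounded on `S`, then for every `n` there is `C` with
`‖Dⁿu(t, x)‖ ≤ C` on `S × ℝ³`: each component `Dⁿu(t,x)(e_σ)` is bounded by the imbedding
`W^{2,2}(ℝ³) ⊂ C_B(ℝ³)` (Adams 1975, Thm. 5.4 Part I Case C; tree
`FunctionSpaces.exists_enorm_le_sobolev_two_two_dim_three`), its `j`-th derivatives being
controlled by `D^{n+j}u(t)` (`norm_iteratedFDeriv_iteratedFDeriv_aux`), and
`‖Dⁿu(t,x)‖ ≤ ∑_σ ‖Dⁿu(t,x)(e_σ)‖`. [cite: Adams1975, Thm. 5.4 Part I Case C (mp > n)] -/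
theorem exists_forall_norm_iteratedFDeriv_le_of_hasBoundedSobolevNormsOn {S : Set ℝ}
    {u : ℝ → ℝ³ → ℝ³} (hu : ∀ t ∈ S, ContDiff ℝ ∞ (u t)) (hB : HasBoundedSobolevNormsOn S u)
    (n : ℕ) : ∃ C : ℝ, ∀ t ∈ S, ∀ x, ‖iteratedFDeriv ℝ n (u t) x‖ ≤ C := by
  set e := stdOrthonormalBasis ℝ ℝ³
  obtain ⟨K, hK, hbound⟩ := FunctionSpaces.exists_enorm_le_sobolev_two_two_dim_three
    (E := ℝ³) (F := ℝ³) (volume : Measure ℝ³) finrank_euclideanSpace_fin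
  choose C hC using hB
  have hG : ∀ t ∈ S, ∀ m : ℕ, ContDiff ℝ m (iteratedFDeriv ℝ n (u t)) := fun t ht m =>
    (hu t ht).iteratedFDeriv_right (i := n) (m := m) (by exact_mod_cast le_top)
  -- each component is bounded, uniformly in `t ∈ S`
  have hcomp : ∀ σ : Fin n → Fin (Module.finrank ℝ ℝ³), ∃ R : ℝ, ∀ t ∈ S, ∀ x,
      ‖iteratedFDeriv ℝ n (u t) x (fun i => e (σ i))‖ ≤ R := by
    intro σ
    set A : (ℝ³ [×n]→L[ℝ] ℝ³) →L[ℝ] ℝ³ :=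
      ContinuousMultilinearMap.apply ℝ (fun _ : Fin n => ℝ³) ℝ³ (fun i => e (σ i)) with hA
    set R : ℝ≥0∞ := K * ∑ j ∈ Finset.range 3,
      (‖A‖₊ : ℝ≥0∞) * ((C (n + j) : ℝ≥0∞) ^ (1 / 2 : ℝ)) with hR
    have hRtop : R < ⊤ := by
      refine ENNReal.mul_lt_top hK (ENNReal.sum_lt_top.2 fun j _ => ?_)
      exact ENNReal.mul_lt_top ENNReal.coe_lt_top
        (ENNReal.rpow_lt_top_of_nonneg (by norm_num) ENNReal.coe_ne_top)
    refine ⟨R.toReal, fun t ht x => ?_⟩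
    have hgσ : ContDiff ℝ 2 (A ∘ iteratedFDeriv ℝ n (u t)) := A.contDiff.comp (hG t ht 2)
    have h1 : ‖(A ∘ iteratedFDeriv ℝ n (u t)) x‖ₑ ≤ R := by
      refine (hbound _ hgσ x).trans ?_
      rw [hR]
      gcongr with j hj
      have hle : ∀ y, ‖iteratedFDeriv ℝ j (A ∘ iteratedFDeriv ℝ n (u t)) y‖ ≤
          ‖A‖ * ‖iteratedFDeriv ℝ (n + j) (u t) y‖ := fun y => by
        rw [← norm_iteratedFDeriv_iteratedFDeriv_aux n j y]
        exact A.norm_iteratedFDeriv_comp_left ((hG t ht j).contDiffAt) le_rfl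
      have h2 : eLpNorm (iteratedFDeriv ℝ j (A ∘ iteratedFDeriv ℝ n (u t))) 2 volume ≤
          ‖A‖₊ • eLpNorm (iteratedFDeriv ℝ (n + j) (u t)) 2 volume :=
        eLpNorm_le_nnreal_smul_eLpNorm_of_ae_le_mul (Eventually.of_forall hle) 2
      refine h2.trans ?_
      rw [ENNReal.smul_def, smul_eq_mul]
      gcongr
      exact eLpNorm_two_le_rpow_of_lintegral_sq_le (hC (n + j) t ht)
    rw [← ofReal_norm] at h1
    have h2 := (ENNReal.ofReal_le_iff_le_toReal hRtop.ne).1 h1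
    simpa [hA] using h2
  choose R hR using hcomp
  refine ⟨∑ σ, R σ, fun t ht x => ?_⟩
  exact (cmm_norm_le_sum_norm_apply_basis e (iteratedFDeriv ℝ n (u t) x)).trans
    (Finset.sum_le_sum fun σ _ => hR σ t ht x)

end SupBounds

/-! ## From Tao's almost regular local `H¹` solutions to Leray's regular package -/

section Package

/-- Local notation for physical space `ℝ³ = EuclideanSpace ℝ (Fin 3)`. -/
local notation "ℝ³" => EuclideanSpace ℝ (Fin 3)

/-- `u ∈ C([a + s, b + s] ; L²)` from `u(· + s) ∈ C([a, b]; L²)` (time translation). [folklore] -/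
theorem ContinuousInLpOn.of_comp_add_right_Icc {u : ℝ → ℝ³ → ℝ³} {a b s : ℝ}
    (h : ContinuousInLpOn (Icc a b) 2 (fun t => u (t + s))) :
    ContinuousInLpOn (Icc (a + s) (b + s)) 2 u := by
  have h1 := h.comp_add_right (-s)
  have hset : (· + -s) ⁻¹' Icc a b = Icc (a + s) (b + s) := by
    ext t
    simp only [mem_preimage, mem_Icc]
    constructor <;> intro ht <;> constructor <;> linarith [ht.1, ht.2]
  rw [hset] at h1
  refine h1.congr_eqOn fun t _ => ?_
  show u (t + -s + s) = u t
  rw [neg_add_cancel_right]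

/-- A square-integrability bound `∫⁻ ‖D⁰ g‖ₑ² ≤ C` makes a continuous `g` an `L²` function. [folklore] -/
theorem memLp_two_of_continuous_of_lintegral_iteratedFDeriv_zero_le {F : Type*} [NormedAddCommGroup F]
    [NormedSpace ℝ F] {g : ℝ³ → F} (hg : Continuous g) {C : ℝ≥0}
    (h : ∫⁻ x, ‖iteratedFDeriv ℝ 0 g x‖ₑ ^ 2 ≤ C) : MemLp g 2 volume := by
  have h' : ∫⁻ x, ‖g x‖ₑ ^ 2 ≤ C := by
    refine le_of_eq_of_le (lintegral_congr fun x => ?_) h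
    rw [← ofReal_norm, ← norm_iteratedFDeriv_zero (𝕜 := ℝ) (f := g), ofReal_norm]
  exact ⟨hg.aestronglyMeasurable, (eLpNorm_two_le_rpow_of_lintegral_sq_le h').trans_lt
    (ENNReal.rpow_lt_top_of_nonneg (by norm_num) ENNReal.coe_ne_top)⟩

/-- A classical solution of the unforced system on a closed slab `[a, T]`, `a < T`, with all
Sobolev norms bounded is continuous into `L²` on `[a, T]` (time translate of the tree's
`isLerayHopfOn_of_finiteEnergy`, Tao 2013, Lemma 8.1: finite energy smooth solutions are in
`C([0,T]; L²)`). [cite: Tao2011, Lemma 8.1] -/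
theorem continuousInLpOn_Icc_of_classical {ν a T : ℝ} (hν : 0 < ν) (haT : a < T)
    {w : ℝ → ℝ³ → ℝ³} {π : ℝ → ℝ³ → ℝ} (hsol : IsClassicalNSSolutionOn (Icc a T) ν 0 w π)
    (hB : HasBoundedSobolevNormsOn (Icc a T) w) : ContinuousInLpOn (Icc a T) 2 w := by
  have h1 : IsClassicalNSSolutionOn (Icc 0 (T - a)) ν 0 (fun t => w (t + a)) (fun t => π (t + a)) := by
    have h := hsol.comp_add_right a
    refine h.mono (fun t ht => ?_) (uniqueDiffOn_Icc (sub_pos.2 haT))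
    exact ⟨by linarith [ht.1], by linarith [ht.2]⟩
  obtain ⟨C₀, hC₀⟩ := hB 0
  have hfe : ∃ A : ℝ≥0∞, A < ⊤ ∧ ∀ t ∈ Icc 0 (T - a), ∫⁻ x, ‖w (t + a) x‖ₑ ^ 2 ≤ A := by
    refine ⟨C₀, ENNReal.coe_lt_top, fun t ht => ?_⟩
    refine le_of_eq_of_le (lintegral_congr fun x => ?_) (hC₀ (t + a) ⟨by linarith [ht.1], by linarith [ht.2]⟩)
    rw [← ofReal_norm, ← norm_iteratedFDeriv_zero (𝕜 := ℝ) (f := w (t + a)), ofReal_norm]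
  have h2 := (isLerayHopfOn_of_finiteEnergy h1 hν (sub_pos.2 haT) hfe).2
  have h3 := ContinuousInLpOn.of_comp_add_right_Icc h2
  rwa [zero_add, sub_add_cancel] at h3

/-- The one-sided time derivative within `(s, T]` and within `[s, T]` agree at `t > s`
(`(s, T] = [s, T] ∩ (s, ∞)` and `(s, ∞)` is a neighbourhood of `t`). [folklore] -/
theorem timeDerivWithin_Ioc_eq_Icc {X F : Type*} [NormedAddCommGroup F] [NormedSpace ℝ F]
    {s T t : ℝ} (w : ℝ → X → F) (hst : s < t) (x : X) :
    timeDerivWithin (Ioc s T) w t x = timeDerivWithin (Icc s T) w t x := by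
  simp only [timeDerivWithin_apply]
  have hset : Icc s T ∩ Ioi s = Ioc s T := by
    ext τ
    simp only [mem_inter_iff, mem_Icc, mem_Ioi, mem_Ioc]
    constructor
    · rintro ⟨⟨-, h2⟩, h3⟩; exact ⟨h3, h2⟩
    · rintro ⟨h1, h2⟩; exact ⟨⟨h1.le, h2⟩, h1⟩
  rw [← hset, derivWithin_inter (Ioi_mem_nhds hst)]

set_option maxHeartbeats 800000 in
/-- **Leray's regular package from Tao's almost regular local `H¹` solutions** (lifespan in terms
of the full `H¹` norm). Assume `TaoH1AlmostRegularWith c` (Tao 2013, Thm. 5.4 (i)–(ii) with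
Prop. 5.6: the local Leray–Hopf solution `v` from `u₀ ∈ H¹`, `‖u₀‖⁴_{H¹} T ≤ c ν³`, is
`H¹`-continuous on `[0, T]` and is represented on every `[τ, T]`, `τ > 0`, by a classical solution
of Tao's class). Then the datum launches a Leray–Hopf weak solution `v` on `[0, T)` with
`v 0 = u₀`, `H¹`-continuous and `L²`-continuous on `[0, T]`, which **is itself** a classical
solution on the time set `(0, T]` for a pressure `p`, with all Sobolev norms of `v`, `∂ₜv`, `p`
bounded and all derivatives of `v` bounded on every `[δ, T] × ℝ³`, `0 < δ ≤ T`
(Ożański–Pooley 2018, Cor. 6.16: `∂ₜᵏ∇ᵐu, ∂ₜᵏ∇ᵐp ∈ C((0,T); L² ∩ L^∞)`). Proof: the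
representatives `(wₙ, πₙ)` on `[T/(n+2), T]` agree on overlaps (continuous slices a.e. equal to
`v(t)`; `L²` pressures, `IsClassicalNSSolutionOn.exists_glue_Ioc_of_memLp`) and glue to a
classical `(v', p)` on `(0, T]`; replacing the slices `v(t)`, `t > 0`, by `v'(t)` keeps the
Leray–Hopf property (`IsLerayHopfOn.congr_ae_slices`) and the `H¹` norms; `L²` continuity holds
on each `[T/(n+2), T]` for classical finite-energy pieces (`continuousInLpOn_Icc_of_classical`)
and at `0⁺` by the strong attainment of the datum; the bounds on `[δ, T]` are those of a piece
containing it, all derivatives being bounded by `H² ⊂ C_B`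
(`exists_forall_norm_iteratedFDeriv_le_of_hasBoundedSobolevNormsOn`). [cite: Tao2011, Thm. 5.4 (i)-(ii) and Prop. 5.6] -/
theorem exists_regular_of_taoH1AlmostRegularWith {c : ℝ} (h : TaoH1AlmostRegularWith c)
    {ν T : ℝ} (hν : 0 < ν) (hT : 0 < T) {u₀ : ℝ³ → ℝ³} (hu₀ : MemLp u₀ 2 volume)
    (hdiv : IsWeaklyDivFree u₀) {A : ℝ} (hA : 0 ≤ A) (hH1 : eH1NormSq u₀ ≤ ENNReal.ofReal A)
    (hsmall : A ^ 2 * T ≤ c * ν ^ 3) :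
    ∃ (v : ℝ → ℝ³ → ℝ³) (p : ℝ → ℝ³ → ℝ),
      IsLerayHopfOn T ν 0 u₀ v ∧ v 0 = u₀ ∧ IsH1RegularOn (Icc 0 T) v ∧
      ContinuousInLpOn (Icc 0 T) 2 v ∧
      IsClassicalNSSolutionOn (Ioc 0 T) ν 0 v p ∧
      ∀ δ : ℝ, 0 < δ → δ ≤ T →
        HasBoundedSobolevNormsOn (Icc δ T) v ∧
        HasBoundedSobolevNormsOn (Icc δ T) (timeDerivWithin (Ioc 0 T) v) ∧
        (∀ n : ℕ, ∃ C : ℝ, ∀ t ∈ Icc δ T, ∀ x, ‖iteratedFDeriv ℝ n (v t) x‖ ≤ C) ∧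
        (∀ n : ℕ, ∃ C : ℝ≥0, ∀ t ∈ Icc δ T, ∫⁻ x, ‖iteratedFDeriv ℝ n (p t) x‖ₑ ^ 2 ≤ C) := by
  obtain ⟨v, hLH, hv0, hreg, hrep⟩ := h hν hT hu₀ hdiv hA hH1 hsmall
  -- the pieces `[s n, T]`, `s n = T / (n + 2)`
  set s : ℕ → ℝ := fun n => T / (n + 2) with hs_def
  have hs0 : ∀ n, 0 < s n := fun n => by positivity
  have hsT : ∀ n, s n < T := fun n => by
    rw [hs_def]
    exact div_lt_self hT (by linarith [n.cast_nonneg (α := ℝ)])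
  have hs : ∀ t, 0 < t → ∃ n : ℕ, s n < t := by
    intro t ht
    obtain ⟨n, hn⟩ := exists_nat_gt (T / t)
    refine ⟨n, ?_⟩
    show T / (n + 2) < t
    rw [div_lt_iff₀ (by positivity)]
    rw [div_lt_iff₀ ht] at hn
    nlinarith
  have hex : ∀ n : ℕ, ∃ (w : ℝ → ℝ³ → ℝ³) (π : ℝ → ℝ³ → ℝ),
      IsClassicalNSSolutionOn (Icc (s n) T) ν 0 w π ∧
      HasBoundedSobolevNormsOn (Icc (s n) T) w ∧
      HasBoundedSobolevNormsOn (Icc (s n) T) (timeDerivWithin (Icc (s n) T) w) ∧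
      (∀ k : ℕ, ∃ C : ℝ≥0, ∀ t ∈ Icc (s n) T, ∫⁻ x, ‖iteratedFDeriv ℝ k (π t) x‖ₑ ^ 2 ≤ C) ∧
      ∀ t ∈ Icc (s n) T, v t =ᵐ[volume] w t := fun n => hrep ⟨hs0 n, hsT n⟩
  choose W P hWsol hWB hWtB hPB hWae using hex
  have hWIoc : ∀ n, IsClassicalNSSolutionOn (Ioc (s n) T) ν 0 (W n) (P n) := fun n =>
    (hWsol n).mono Ioc_subset_Icc_self (uniqueDiffOn_Ioc (s n) T)
  -- representatives agree on overlaps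
  have hagree : ∀ m n, ∀ t ∈ Ioc (max (s m) (s n)) T, W m t = W n t := by
    intro m n t ht
    have htm : t ∈ Icc (s m) T := ⟨(le_max_left _ _).trans ht.1.le, ht.2⟩
    have htn : t ∈ Icc (s n) T := ⟨(le_max_right _ _).trans ht.1.le, ht.2⟩
    have hae : W m t =ᵐ[volume] W n t := (hWae m t htm).symm.trans (hWae n t htn)
    exact ((hWsol m).contDiff_velocity htm).continuous.ae_eq_iff_eq volume
      ((hWsol n).contDiff_velocity htn).continuous |>.1 hae
  have hPmem : ∀ n, ∀ t ∈ Ioc (s n) T, MemLp (P n t) 2 volume := by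
    intro n t ht
    obtain ⟨C, hC⟩ := hPB n 0
    exact memLp_two_of_continuous_of_lintegral_iteratedFDeriv_zero_le
      ((hWsol n).contDiff_pressure (Ioc_subset_Icc_self ht)).continuous (hC t (Ioc_subset_Icc_self ht))
  obtain ⟨v', p, hsol', hv'W, hpP⟩ :=
    IsClassicalNSSolutionOn.exists_glue_Ioc_of_memLp hs0 hs hWIoc hagree hPmem
  -- the modified velocity
  set u : ℝ → ℝ³ → ℝ³ := fun t => if 0 < t then v' t else v t with hu_def
  have hu_pos : ∀ t, 0 < t → u t = v' t := fun t ht => by simp [hu_def, ht]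
  have hu_zero : u 0 = u₀ := by simp [hu_def, hv0]
  have huW : ∀ n, ∀ t ∈ Ioc (s n) T, u t = W n t := fun n t ht => by
    rw [hu_pos t ((hs0 n).trans ht.1), hv'W n t ht]
  have hu_ae : ∀ t ∈ Icc 0 T, u t =ᵐ[volume] v t := by
    intro t ht
    rcases eq_or_lt_of_le ht.1 with h0 | h0
    · rw [← h0, hu_zero, hv0]
    · obtain ⟨n, hn⟩ := hs t h0
      rw [huW n t ⟨hn, ht.2⟩]
      exact (hWae n t ⟨hn.le, ht.2⟩).symm
  have hsolu : IsClassicalNSSolutionOn (Ioc 0 T) ν 0 u p :=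
    hsol'.congr_slices (fun t ht => hu_pos t ht.1) fun _ _ => rfl
  -- joint measurability on `(0, T) × ℝ³`
  have hum : AEStronglyMeasurable (uncurry u) (volume.restrict (Ioo 0 T ×ˢ univ)) := by
    have hc : ContinuousOn (uncurry u) (Ioo 0 T ×ˢ univ) :=
      (hsolu.smooth_velocity.continuousOn).mono (prod_mono Ioo_subset_Ioc_self Subset.rfl)
    exact hc.aestronglyMeasurable (measurableSet_Ioo.prod MeasurableSet.univ)
  have hLHu : IsLerayHopfOn T ν 0 u₀ u := hLH.congr_ae_slices hT hum hu_ae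
  -- `H¹` regularity transfers along a.e.-equal slices
  have hregu : IsH1RegularOn (Icc 0 T) u := by
    have heq : ∀ t ∈ Icc 0 T, eH1NormSq (u t) = eH1NormSq (v t) := fun t ht =>
      eH1NormSq_congr_ae (hu_ae t ht)
    exact ⟨fun t ht => (heq t ht).symm ▸ hreg.1 t ht, hreg.2.congr heq⟩
  -- `L²` continuity of the pieces and of `u`
  have hcW : ∀ n, ContinuousInLpOn (Icc (s n) T) 2 (W n) := fun n =>
    continuousInLpOn_Icc_of_classical hν (hsT n) (hWsol n) (hWB n)
  have hcu : ContinuousInLpOn (Icc 0 T) 2 u := by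
    refine ⟨fun t ht => hLHu.memLp t ht, fun t₀ ht₀ => ?_⟩
    rcases eq_or_lt_of_le ht₀.1 with h0 | h0
    · -- at `t₀ = 0`: strong attainment of the datum
      rw [← h0, hu_zero]
      have h1 : Tendsto (fun t => eLpNorm (u t - u₀) 2 volume) (𝓝[Ioc 0 T] 0) (𝓝 0) :=
        hLHu.strong_initial.mono_left (nhdsWithin_mono _ Ioc_subset_Ioi_self)
      have h2 : Tendsto (fun t => eLpNorm (u t - u₀) 2 volume) (pure 0) (𝓝 0) := by
        rw [tendsto_pure_left]
        intro U hU
        rw [hu_zero, sub_self, eLpNorm_zero]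
        exact mem_of_mem_nhds hU
      rw [← Ioc_union_left hT.le, union_singleton, nhdsWithin_insert]
      exact h2.sup h1
    · -- at `t₀ > 0`: the piece containing `t₀`
      obtain ⟨n, hn⟩ := hs t₀ h0
      have hmem : Ioi (s n) ∈ 𝓝[Icc 0 T] t₀ := mem_nhdsWithin_of_mem_nhds (Ioi_mem_nhds hn)
      have hfilter : 𝓝[Icc 0 T] t₀ ≤ 𝓝[Icc (s n) T] t₀ := by
        rw [← nhdsWithin_inter_of_mem hmem]
        exact nhdsWithin_mono _ fun t ht => ⟨ht.1.le, ht.2.2⟩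
      have h1 := ((hcW n).2 t₀ ⟨hn.le, ht₀.2⟩).mono_left hfilter
      refine h1.congr' ?_
      filter_upwards [hmem, self_mem_nhdsWithin] with t ht htI
      rw [huW n t ⟨ht, htI.2⟩, huW n t₀ ⟨hn, ht₀.2⟩]
  refine ⟨u, p, hLHu, hu_zero, hregu, hcu, hsolu, fun δ hδ hδT => ?_⟩
  obtain ⟨n, hn⟩ := hs δ hδ
  have hsub : Icc δ T ⊆ Ioc (s n) T := fun t ht => ⟨hn.trans_le ht.1, ht.2⟩
  have hsub' : Icc δ T ⊆ Icc (s n) T := fun t ht => ⟨hn.le.trans ht.1, ht.2⟩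
  have hBu : HasBoundedSobolevNormsOn (Icc δ T) u := fun k =>
    ((hWB n) k).imp fun C hC t ht => by
      rw [huW n t (hsub ht)]
      exact hC t (hsub' ht)
  have hdt : ∀ t ∈ Icc δ T, timeDerivWithin (Ioc 0 T) u t = timeDerivWithin (Icc (s n) T) (W n) t := by
    intro t ht
    funext x
    rw [timeDerivWithin_Ioc_eq_of_eqOn (hs0 n).le (hsub ht).1 (huW n) ht.2 x,
      timeDerivWithin_Ioc_eq_Icc (W n) (hsub ht).1 x]
  have hBdt : HasBoundedSobolevNormsOn (Icc δ T) (timeDerivWithin (Ioc 0 T) u) := fun k =>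
    ((hWtB n) k).imp fun C hC t ht => by
      rw [hdt t ht]
      exact hC t (hsub' ht)
  refine ⟨hBu, hBdt, fun k => ?_, fun k => ?_⟩
  · exact exists_forall_norm_iteratedFDeriv_le_of_hasBoundedSobolevNormsOn
      (fun t ht => hsolu.contDiff_velocity ⟨hδ.trans_le ht.1, ht.2⟩) hBu k
  · obtain ⟨C, hC⟩ := hPB n k
    exact ⟨C, fun t ht => by rw [hpP n t (hsub ht)]; exact hC t (hsub' ht)⟩

end Package

/-! ## The Navier–Stokes scaling of the slice functionals and of the regularity clauses on `ℝ³` -/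

section Scaling

/-- Local notation for physical space `ℝ³ = EuclideanSpace ℝ (Fin 3)`. -/
local notation "ℝ³" => EuclideanSpace ℝ (Fin 3)

/-- **Scaling of the weak dissipation**: `eWeakGradL2Sq (c w(c ·)) = c⁴ (cⁿ)⁻¹ eWeakGradL2Sq w`
(`c > 0`): weak gradients correspond under the dilation (`hasWeakGradient_nsRescaleData` in both
directions), and the weak dissipation is attained by any weak gradient
(`eWeakGradL2Sq_eq_of_hasWeakGradient`); without a weak gradient both sides are `∞`. [folklore] -/
theorem eWeakGradL2Sq_nsRescaleData {E : Type*} [NormedAddCommGroup E] [InnerProductSpace ℝ E]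
    [FiniteDimensional ℝ E] [MeasurableSpace E] [BorelSpace E] {F' : Type*}
    [NormedAddCommGroup F'] [InnerProductSpace ℝ F'] [CompleteSpace F'] {c : ℝ} (hc : 0 < c)
    (w : E → F') :
    eWeakGradL2Sq (nsRescaleData c w) =
      ENNReal.ofReal (c ^ 4) * ENNReal.ofReal (c ^ Module.finrank ℝ E)⁻¹ * eWeakGradL2Sq w := by
  by_cases hw : ∃ G : E → E →L[ℝ] F', HasWeakGradient w G
  · obtain ⟨G, hG⟩ := hw
    rw [eWeakGradL2Sq_eq_of_hasWeakGradient (hasWeakGradient_nsRescaleData hG hc),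
      eWeakGradL2Sq_eq_of_hasWeakGradient hG, lintegral_frobeniusNormSq_nsRescaleGrad hc]
  · -- neither `w` nor its rescaling has a weak gradient
    have hw' : ¬ ∃ G' : E → E →L[ℝ] F', HasWeakGradient (nsRescaleData c w) G' := by
      rintro ⟨G', hG'⟩
      refine hw ⟨fun x => c⁻¹ ^ 2 • G' (c⁻¹ • x), ?_⟩
      have h2 := hasWeakGradient_nsRescaleData hG' (inv_pos.2 hc)
      have e : nsRescaleData c⁻¹ (nsRescaleData c w) = w := by
        funext x
        rw [nsRescaleData_apply, nsRescaleData_apply, smul_smul, smul_smul,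
          mul_inv_cancel₀ hc.ne', inv_mul_cancel₀ hc.ne', one_smul, one_smul]
      rwa [e] at h2
    have h1 : eWeakGradL2Sq w = ⊤ := by
      rw [eWeakGradL2Sq, iInf_eq_top]
      intro G
      rw [iInf_eq_top]
      intro hG
      exact absurd ⟨G, hG⟩ hw
    have h2 : eWeakGradL2Sq (nsRescaleData c w) = ⊤ := by
      rw [eWeakGradL2Sq, iInf_eq_top]
      intro G
      rw [iInf_eq_top]
      intro hG
      exact absurd ⟨G, hG⟩ hw'
    rw [h1, h2, ENNReal.mul_top]
    exact mul_ne_zero (ENNReal.ofReal_pos.2 (by positivity)).ne'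
      (ENNReal.ofReal_pos.2 (by positivity)).ne'

/-- On `ℝ³`: `eEnergy (c w(c ·)) = c⁻¹ eEnergy w` (`c > 0`). [folklore] -/
theorem eEnergy_nsRescaleData_three {F : Type*} [NormedAddCommGroup F] [NormedSpace ℝ F]
    {c : ℝ} (hc : 0 < c) (w : ℝ³ → F) :
    eEnergy (nsRescaleData c w) = ENNReal.ofReal c⁻¹ * eEnergy w := by
  rw [eEnergy_nsRescaleData hc, finrank_euclideanSpace_fin, ← ENNReal.ofReal_mul (sq_nonneg c)]
  congr 2
  field_simp

/-- On `ℝ³`: `eWeakGradL2Sq (c w(c ·)) = c eWeakGradL2Sq w` (`c > 0`). [folklore] -/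
theorem eWeakGradL2Sq_nsRescaleData_three {c : ℝ} (hc : 0 < c) (w : ℝ³ → ℝ³) :
    eWeakGradL2Sq (nsRescaleData c w) = ENNReal.ofReal c * eWeakGradL2Sq w := by
  rw [eWeakGradL2Sq_nsRescaleData hc, finrank_euclideanSpace_fin, ← ENNReal.ofReal_mul (by positivity)]
  congr 2
  field_simp

/-- **Sobolev seminorms under dilation.** For a `Cⁿ` map `g` on `ℝ³`, `κ ∈ ℝ` and `a > 0`,
`∫⁻ ‖Dⁿ(κ g(a ·))‖ₑ² ≤ (|κ| aⁿ)² (a³)⁻¹ ∫⁻ ‖Dⁿg‖ₑ²` (chain rule `‖Dⁿ(κ g(a ·))(x)‖ ≤ |κ| aⁿ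
‖Dⁿg(a x)‖`, `norm_iteratedFDeriv_rescale_le`, and the substitution `y = a x`). [folklore] -/
theorem lintegral_iteratedFDeriv_dilate_sq_le {F : Type*} [NormedAddCommGroup F] [NormedSpace ℝ F]
    {g : ℝ³ → F} {n : ℕ} (hg : ContDiff ℝ n g) (κ : ℝ) {a : ℝ} (ha : 0 < a) :
    ∫⁻ x, ‖iteratedFDeriv ℝ n (fun x => κ • g (a • x)) x‖ₑ ^ 2 ≤
      ENNReal.ofReal ((|κ| * a ^ n) ^ 2) * ENNReal.ofReal (a ^ 3)⁻¹ *
        ∫⁻ y, ‖iteratedFDeriv ℝ n g y‖ₑ ^ 2 := by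
  have hfun : (fun x => κ • g (a • x)) = fun x => κ • g (a • x - 0) := by
    funext x; rw [sub_zero]
  have hpt : ∀ x, ‖iteratedFDeriv ℝ n (fun x => κ • g (a • x)) x‖ₑ ^ 2 ≤
      ENNReal.ofReal ((|κ| * a ^ n) ^ 2) * ‖iteratedFDeriv ℝ n g (a • x)‖ₑ ^ 2 := by
    intro x
    have h1 := FunctionSpaces.norm_iteratedFDeriv_rescale_le hg κ a (0 : ℝ³) le_rfl x
    rw [← hfun] at h1
    rw [sub_zero, abs_of_pos ha] at h1
    have h2 := pow_le_pow_left₀ (norm_nonneg _) h1 2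
    rw [mul_pow] at h2
    calc ‖iteratedFDeriv ℝ n (fun x => κ • g (a • x)) x‖ₑ ^ 2
        = ENNReal.ofReal (‖iteratedFDeriv ℝ n (fun x => κ • g (a • x)) x‖ ^ 2) := by
          rw [← ofReal_norm, ENNReal.ofReal_pow (norm_nonneg _)]
      _ ≤ ENNReal.ofReal ((|κ| * a ^ n) ^ 2 * ‖iteratedFDeriv ℝ n g (a • x)‖ ^ 2) :=
          ENNReal.ofReal_le_ofReal h2
      _ = ENNReal.ofReal ((|κ| * a ^ n) ^ 2) * ‖iteratedFDeriv ℝ n g (a • x)‖ₑ ^ 2 := by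
          rw [ENNReal.ofReal_mul (sq_nonneg _), ← ofReal_norm (iteratedFDeriv ℝ n g (a • x)),
            ENNReal.ofReal_pow (norm_nonneg _)]
  refine (lintegral_mono hpt).trans ?_
  have e := lintegral_comp_space_affine ha (0 : ℝ³) (fun y => ‖iteratedFDeriv ℝ n g y‖ₑ ^ 2)
  simp only [zero_add, finrank_euclideanSpace_fin] at e
  rw [lintegral_const_mul' _ _ ENNReal.ofReal_ne_top, e, mul_assoc]

/-- **`L²` continuity gives continuity of the extended energy** `t ↦ ∫⁻ ‖u(t)‖ₑ²` (through
`ContinuousInLpOn.tendsto_kineticEnergy` and `eEnergy = ofReal (2E)` on `L²` slices). [folklore] -/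
theorem ContinuousInLpOn.continuousOn_eEnergy {S : Set ℝ} {u : ℝ → ℝ³ → ℝ³}
    (h : ContinuousInLpOn S 2 u) : ContinuousOn (fun t => eEnergy (u t)) S := by
  intro t₀ ht₀
  have h1 : Tendsto (fun t => ENNReal.ofReal (2 * VectorCalculus.kineticEnergy (u t))) (𝓝[S] t₀)
      (𝓝 (ENNReal.ofReal (2 * VectorCalculus.kineticEnergy (u t₀)))) :=
    ENNReal.tendsto_ofReal ((h.tendsto_kineticEnergy ht₀).const_mul 2)
  rw [ContinuousWithinAt, eEnergy_eq_ofReal _ (h.1 t₀ ht₀)]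
  refine h1.congr' ?_
  filter_upwards [self_mem_nhdsWithin] with t ht
  rw [eEnergy_eq_ofReal _ (h.1 t ht)]

/-- **Continuity of the weak dissipation of an `H¹`-regular, `L²`-continuous trajectory**:
`t ↦ ∫⁻ |∇u(t)|² = ‖u(t)‖²_{H¹} - ∫⁻ ‖u(t)‖ₑ²` is continuous on `S` (subtraction in `[0, ∞]` is
continuous at pairs with a finite entry). [folklore] -/
theorem IsH1RegularOn.continuousOn_eWeakGradL2Sq {S : Set ℝ} {u : ℝ → ℝ³ → ℝ³}
    (hreg : IsH1RegularOn S u) (hc : ContinuousInLpOn S 2 u) :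
    ContinuousOn (fun t => eWeakGradL2Sq (u t)) S := by
  have hfin : ∀ t ∈ S, eEnergy (u t) ≠ ⊤ := fun t ht =>
    (lt_of_le_of_lt le_self_add (hreg.1 t ht)).ne
  have heq : ∀ t ∈ S, eWeakGradL2Sq (u t) = eH1NormSq (u t) - eEnergy (u t) := fun t ht => by
    rw [eH1NormSq_def, ENNReal.add_sub_cancel_left (hfin t ht)]
  intro t₀ ht₀
  have h1 := ENNReal.Tendsto.sub (hreg.2 t₀ ht₀) (hc.continuousOn_eEnergy t₀ ht₀)
    (Or.inl (hreg.1 t₀ ht₀).ne)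
  rw [ContinuousWithinAt, heq t₀ ht₀]
  refine h1.congr' ?_
  filter_upwards [self_mem_nhdsWithin] with t ht
  exact (heq t ht).symm

/-- **Lifespan in terms of the gradient: Leray's package from Tao's.** `TaoH1AlmostRegularWith c`
(smallness `‖u₀‖⁴_{H¹} T ≤ c ν³`, full `H¹` norm) implies `LerayLocalRegularH1With (c/4)`
(smallness `‖∇u₀‖⁴_{L²} T ≤ (c/4) ν³`, Robinson–Rodrigo–Sadowski 2016, Thm. 6.15; Ożański–Pooley
2018, Thm. 6.30: `T₀ ≥ C‖∇u₀‖⁻⁴`), by the Navier–Stokes scaling `u₀ ↦ λ u₀(λ ·)` (Leray 1934,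
§20), under which `‖u₀‖²_{L²} ↦ λ⁻¹‖u₀‖²_{L²}`, `‖∇u₀‖²_{L²} ↦ λ ‖∇u₀‖²_{L²}`, `T ↦ T/λ²`: for
`λ` large the rescaled datum satisfies Tao's smallness on `[0, T/λ²]`, and the regular package of
`exists_regular_of_taoH1AlmostRegularWith` is scaled back by `λ⁻¹` — Leray–Hopf solutions
(`isLerayHopfOn_nsRescale`), classical solutions (`IsClassicalNSSolutionOn.nsRescale_holds`),
`H¹`-continuity (`eEnergy_nsRescaleData_three`, `eWeakGradL2Sq_nsRescaleData_three` with the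
continuity of energy and weak dissipation separately) and the Sobolev bounds
(`lintegral_iteratedFDeriv_dilate_sq_le`, `timeDerivWithin_smul_stPull`) are all covariant. [cite: RobinsonRodrigoSadowski2016, Thm. 6.15] -/
theorem lerayLocalRegularH1With_of_taoH1AlmostRegularWith {c : ℝ} (hc : 0 < c)
    (h : TaoH1AlmostRegularWith c) : LerayLocalRegularH1With (c / 4) := by
  intro ν T hν hT u₀ hu₀ hdiv A hA hgrad hsmall
  have hν3 : 0 < ν ^ 3 := pow_pos hν 3
  -- the finite initial energy
  have hEtop : eEnergy u₀ ≠ ⊤ := by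
    rw [eEnergy_eq_ofReal _ hu₀]; exact ENNReal.ofReal_ne_top
  set E₀ : ℝ := (eEnergy u₀).toReal with hE₀_def
  have hE₀ : 0 ≤ E₀ := ENNReal.toReal_nonneg
  have hE₀eq : eEnergy u₀ = ENNReal.ofReal E₀ := (ENNReal.ofReal_toReal hEtop).symm
  clear_value E₀
  -- the room `ε` left by the smallness hypothesis, and the dilation factor `λ`
  set ε : ℝ := Real.sqrt (c * ν ^ 3 / (4 * T)) with hε_def
  have hε : 0 < ε := Real.sqrt_pos.2 (by positivity)
  have hε2 : ε ^ 2 = c * ν ^ 3 / (4 * T) := Real.sq_sqrt (by positivity)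
  have hAε : (A + ε) ^ 2 * T ≤ c * ν ^ 3 := by
    have h1 : (A + ε) ^ 2 ≤ 2 * A ^ 2 + 2 * ε ^ 2 := by nlinarith [sq_nonneg (A - ε)]
    have h2 : 2 * ε ^ 2 * T = c * ν ^ 3 / 2 := by
      rw [hε2]; field_simp; ring
    nlinarith [mul_le_mul_of_nonneg_right h1 hT.le]
  clear_value ε
  set lam : ℝ := Real.sqrt (E₀ / ε) + 1 with hlam_def
  have hlam : 0 < lam := by positivity
  have hlamE : lam⁻¹ ^ 2 * E₀ ≤ ε := by
    have h1 : E₀ / ε ≤ lam ^ 2 := by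
      have h2 : Real.sqrt (E₀ / ε) ^ 2 = E₀ / ε := Real.sq_sqrt (by positivity)
      nlinarith [Real.sqrt_nonneg (E₀ / ε)]
    rw [div_le_iff₀ hε] at h1
    rw [inv_pow, inv_mul_le_iff₀ (by positivity)]
    linarith
  clear_value lam
  -- the rescaled datum and its size
  set w₀ : ℝ³ → ℝ³ := nsRescaleData lam u₀ with hw₀_def
  set Aw : ℝ := lam⁻¹ * E₀ + lam * A with hAw_def
  have hAw : 0 ≤ Aw := by positivity
  have hw₀2 : MemLp w₀ 2 volume := memLp_nsRescaleData hu₀ hlam.ne'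
  have hw₀div : IsWeaklyDivFree w₀ := hdiv.nsRescaleData hlam
  clear_value Aw
  have hw₀H1 : eH1NormSq w₀ ≤ ENNReal.ofReal Aw := by
    rw [eH1NormSq_def, hw₀_def, eEnergy_nsRescaleData_three hlam,
      eWeakGradL2Sq_nsRescaleData_three hlam, hAw_def,
      ENNReal.ofReal_add (by positivity) (by positivity),
      ENNReal.ofReal_mul (inv_nonneg.2 hlam.le), ENNReal.ofReal_mul hlam.le, hE₀eq]
    exact add_le_add le_rfl (mul_le_mul' le_rfl hgrad)
  clear_value w₀
  set Tw : ℝ := T / lam ^ 2 with hTw_def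
  have hTw : 0 < Tw := by positivity
  clear_value Tw
  have hsmallw : Aw ^ 2 * Tw ≤ c * ν ^ 3 := by
    have e1 : Aw ^ 2 * Tw = (lam⁻¹ ^ 2 * E₀ + A) ^ 2 * T := by
      rw [hAw_def, hTw_def]; field_simp
    rw [e1]
    have h1 : (lam⁻¹ ^ 2 * E₀ + A) ^ 2 * T ≤ (A + ε) ^ 2 * T := by
      have h3 : 0 ≤ lam⁻¹ ^ 2 * E₀ + A := by positivity
      have h4 : lam⁻¹ ^ 2 * E₀ + A ≤ A + ε := by linarith
      exact mul_le_mul_of_nonneg_right (pow_le_pow_left₀ h3 h4 2) hT.le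
    exact h1.trans hAε
  -- Tao's regular package for the rescaled datum on `[0, Tw]`
  obtain ⟨w, π, hLHw, hw0, hregw, hcw, hsolw, hbdw⟩ :=
    exists_regular_of_taoH1AlmostRegularWith h hν hTw hw₀2 hw₀div hAw hw₀H1 hsmallw
  -- scale back by `a = λ⁻¹`
  obtain ⟨a, ha_def⟩ : ∃ a : ℝ, a = lam⁻¹ := ⟨_, rfl⟩
  have ha : 0 < a := by rw [ha_def]; exact inv_pos.2 hlam
  have ha2 : 0 < a ^ 2 := pow_pos ha 2
  have hTa : Tw / a ^ 2 = T := by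
    rw [hTw_def, ha_def]; field_simp
  have haT : ∀ t, a ^ 2 * t ∈ Ioc 0 Tw ↔ t ∈ Ioc 0 T := by
    intro t
    rw [← hTa, mem_Ioc, mem_Ioc, le_div_iff₀ ha2, mul_comm t]
    exact ⟨fun h => ⟨pos_of_mul_pos_right h.1 ha2.le, h.2⟩, fun h => ⟨mul_pos ha2 h.1, h.2⟩⟩
  have hdat : nsRescaleData a w₀ = u₀ := by
    rw [hw₀_def, ha_def, ← nsRescaleData_mul, mul_inv_cancel₀ hlam.ne', nsRescaleData_one]
  obtain ⟨v, hv_def⟩ : ∃ v : ℝ → ℝ³ → ℝ³, v = FluidPDE.nsRescale a w := ⟨_, rfl⟩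
  obtain ⟨p, hp_def⟩ : ∃ p : ℝ → ℝ³ → ℝ, p = nsRescalePressure a π := ⟨_, rfl⟩
  have hvt : ∀ t, v t = nsRescaleData a (w (a ^ 2 * t)) := fun t => by
    rw [hv_def]; exact nsRescale_slice a w t
  -- (1) Leray–Hopf and the datum
  have hLH : IsLerayHopfOn T ν 0 u₀ v := by
    have h1 := isLerayHopfOn_nsRescale hLHw ha
    rwa [hTa, nsRescaleForce_zero, hdat, ← hv_def] at h1
  have hv0 : v 0 = u₀ := by
    rw [hvt, mul_zero, hw0, hdat]
  -- (2) classical on `(0, T]`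
  have hsol : IsClassicalNSSolutionOn (Ioc 0 T) ν 0 v p := by
    have h1 := IsClassicalNSSolutionOn.nsRescale_holds hsolw ha
    have hS : (fun t => a ^ 2 * t) ⁻¹' Ioc 0 Tw = Ioc 0 T := by
      ext t; exact haT t
    rwa [hS, nsRescaleForce_zero, ← hv_def, ← hp_def] at h1
  -- (3) `H¹` continuity: energy and weak dissipation scale separately
  have hmaps : MapsTo (fun t => a ^ 2 * t) (Icc 0 T) (Icc 0 Tw) := fun t ht =>
    ⟨mul_nonneg ha2.le ht.1, by
      have h2 : t ≤ Tw / a ^ 2 := ht.2.trans_eq hTa.symm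
      rwa [le_div_iff₀ ha2, mul_comm] at h2⟩
  have hreg : IsH1RegularOn (Icc 0 T) v := by
    have heq : ∀ t, eH1NormSq (v t) = ENNReal.ofReal a⁻¹ * eEnergy (w (a ^ 2 * t)) +
        ENNReal.ofReal a * eWeakGradL2Sq (w (a ^ 2 * t)) := fun t => by
      rw [hvt, eH1NormSq_def, eEnergy_nsRescaleData_three ha, eWeakGradL2Sq_nsRescaleData_three ha]
    refine ⟨fun t ht => ?_, ?_⟩
    · have hfin := hregw.1 (a ^ 2 * t) (hmaps ht)
      rw [eH1NormSq_def] at hfin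
      rw [heq]
      exact ENNReal.add_lt_top.2 ⟨ENNReal.mul_lt_top ENNReal.ofReal_lt_top
        (lt_of_le_of_lt le_self_add hfin), ENNReal.mul_lt_top ENNReal.ofReal_lt_top
        (lt_of_le_of_lt le_add_self hfin)⟩
    · have hE : ContinuousOn (fun t => eEnergy (w (a ^ 2 * t))) (Icc 0 T) :=
        hcw.continuousOn_eEnergy.comp (continuous_const_mul (a ^ 2)).continuousOn hmaps
      have hG : ContinuousOn (fun t => eWeakGradL2Sq (w (a ^ 2 * t))) (Icc 0 T) :=
        (hregw.continuousOn_eWeakGradL2Sq hcw).comp (continuous_const_mul (a ^ 2)).continuousOn hmaps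
      have h1 : ContinuousOn (fun t => ENNReal.ofReal a⁻¹ * eEnergy (w (a ^ 2 * t)) +
          ENNReal.ofReal a * eWeakGradL2Sq (w (a ^ 2 * t))) (Icc 0 T) := by
        refine ContinuousOn.add ?_ ?_
        · exact fun t ht => ENNReal.Tendsto.const_mul (hE t ht) (Or.inr ENNReal.ofReal_ne_top)
        · exact fun t ht => ENNReal.Tendsto.const_mul (hG t ht) (Or.inr ENNReal.ofReal_ne_top)
      exact h1.congr fun t _ => heq t
  -- (4) the bounds on `[δ, T]`
  refine ⟨v, p, hLH, hv0, hreg, hsol, fun δ hδ hδT => ?_⟩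
  have hδw : 0 < a ^ 2 * δ := mul_pos ha2 hδ
  have hδwT : a ^ 2 * δ ≤ Tw := (hmaps ⟨hδ.le, hδT⟩).2
  obtain ⟨hBw, hBtw, -, hPw⟩ := hbdw (a ^ 2 * δ) hδw hδwT
  have hmapsδ : ∀ t ∈ Icc δ T, a ^ 2 * t ∈ Icc (a ^ 2 * δ) Tw := fun t ht =>
    ⟨mul_le_mul_of_nonneg_left ht.1 ha2.le, (hmaps ⟨hδ.le.trans ht.1, ht.2⟩).2⟩
  have hIocw : ∀ t ∈ Icc δ T, a ^ 2 * t ∈ Ioc 0 Tw := fun t ht =>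
    ⟨mul_pos ha2 (hδ.trans_le ht.1), (hmapsδ t ht).2⟩
  -- velocity
  have hBv : HasBoundedSobolevNormsOn (Icc δ T) v := by
    intro n
    obtain ⟨C, hC⟩ := hBw n
    have hK : ENNReal.ofReal ((|a| * a ^ n) ^ 2) * ENNReal.ofReal (a ^ 3)⁻¹ * (C : ℝ≥0∞) ≠ ⊤ :=
      ENNReal.mul_ne_top (ENNReal.mul_ne_top ENNReal.ofReal_ne_top ENNReal.ofReal_ne_top)
        ENNReal.coe_ne_top
    refine ⟨(ENNReal.ofReal ((|a| * a ^ n) ^ 2) * ENNReal.ofReal (a ^ 3)⁻¹ * C).toNNReal,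
      fun t ht => ?_⟩
    rw [ENNReal.coe_toNNReal hK, hvt]
    have hsm : ContDiff ℝ n (w (a ^ 2 * t)) :=
      (hsolw.contDiff_velocity (hIocw t ht)).of_le (by exact_mod_cast le_top)
    exact (lintegral_iteratedFDeriv_dilate_sq_le hsm a ha).trans
      (mul_le_mul' le_rfl (hC _ (hmapsδ t ht)))
  -- time derivative: `∂ₜv(t, x) = a³ (∂ₜw)(a²t, a x)`
  have hdtv : ∀ t x, timeDerivWithin (Ioc 0 T) v t x =
      (a * a ^ 2) • timeDerivWithin (Ioc 0 Tw) w (a ^ 2 * t) (a • x) := by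
    intro t x
    have hS : (fun r => (0 : ℝ) + a ^ 2 * r) ⁻¹' Ioc 0 Tw = Ioc 0 T := by
      ext r; rw [mem_preimage, zero_add]; exact haT r
    have h1 := timeDerivWithin_smul_stPull (Ioc 0 Tw) w a ha2.ne' a 0 (0 : ℝ³) t x
    rw [hS, ← nsRescale_eq_smul_stPull, zero_add, zero_add, ← hv_def] at h1
    exact h1
  have hBdtv : HasBoundedSobolevNormsOn (Icc δ T) (timeDerivWithin (Ioc 0 T) v) := by
    intro n
    obtain ⟨C, hC⟩ := hBtw n
    have hK : ENNReal.ofReal ((|a * a ^ 2| * a ^ n) ^ 2) * ENNReal.ofReal (a ^ 3)⁻¹ * (C : ℝ≥0∞) ≠ ⊤ :=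
      ENNReal.mul_ne_top (ENNReal.mul_ne_top ENNReal.ofReal_ne_top ENNReal.ofReal_ne_top)
        ENNReal.coe_ne_top
    refine ⟨(ENNReal.ofReal ((|a * a ^ 2| * a ^ n) ^ 2) * ENNReal.ofReal (a ^ 3)⁻¹ * C).toNNReal,
      fun t ht => ?_⟩
    rw [ENNReal.coe_toNNReal hK]
    have hfun : timeDerivWithin (Ioc 0 T) v t =
        fun x => (a * a ^ 2) • timeDerivWithin (Ioc 0 Tw) w (a ^ 2 * t) (a • x) :=
      funext (hdtv t)
    rw [hfun]
    have hsmw : IsSmoothSpaceTimeOn (Ioc 0 Tw) (timeDerivWithin (Ioc 0 Tw) w) :=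
      hsolw.smooth_velocity.timeDerivWithin (uniqueDiffOn_Ioc 0 Tw)
    have hsm : ContDiff ℝ n (timeDerivWithin (Ioc 0 Tw) w (a ^ 2 * t)) :=
      (hsmw.contDiff_slice (hIocw t ht)).of_le (by exact_mod_cast le_top)
    exact (lintegral_iteratedFDeriv_dilate_sq_le hsm (a * a ^ 2) ha).trans
      (mul_le_mul' le_rfl (hC _ (hmapsδ t ht)))
  refine ⟨hBv, hBdtv, fun n => ?_, fun n => ?_⟩
  · -- all derivatives of `v` bounded
    exact exists_forall_norm_iteratedFDeriv_le_of_hasBoundedSobolevNormsOn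
      (fun t ht => hsol.contDiff_velocity ⟨hδ.trans_le ht.1, ht.2⟩) hBv n
  · -- pressure
    obtain ⟨C, hC⟩ := hPw n
    have hK : ENNReal.ofReal ((|a ^ 2| * a ^ n) ^ 2) * ENNReal.ofReal (a ^ 3)⁻¹ * (C : ℝ≥0∞) ≠ ⊤ :=
      ENNReal.mul_ne_top (ENNReal.mul_ne_top ENNReal.ofReal_ne_top ENNReal.ofReal_ne_top)
        ENNReal.coe_ne_top
    refine ⟨(ENNReal.ofReal ((|a ^ 2| * a ^ n) ^ 2) * ENNReal.ofReal (a ^ 3)⁻¹ * C).toNNReal,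
      fun t ht => ?_⟩
    rw [ENNReal.coe_toNNReal hK]
    have hfun : p t = fun x => (a ^ 2) • π (a ^ 2 * t) (a • x) := by
      funext x; rw [hp_def, nsRescalePressure_apply, smul_eq_mul]
    rw [hfun]
    have hsm : ContDiff ℝ n (π (a ^ 2 * t)) :=
      (hsolw.contDiff_pressure (hIocw t ht)).of_le (by exact_mod_cast le_top)
    exact (lintegral_iteratedFDeriv_dilate_sq_le hsm (a ^ 2) ha).trans
      (mul_le_mul' le_rfl (hC _ (hmapsδ t ht)))

end Scaling

/-! ## The reductions and the discharges they allow -/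

section Reductions

/-- **`tao2011_H1_local_almost_regular → leray_local_regular_H1`**: Leray's local regular
solutions from `H¹` data with lifespan `c ν³ ‖∇u₀‖⁻⁴` (Leray 1934, Ch. III §§19–24;
Ożański–Pooley 2018, Thm. 6.30, Cor. 6.16, Lemma 6.29; Robinson–Rodrigo–Sadowski 2016, Thm. 6.15)
follow from Tao's almost regular local `H¹` solutions (Tao 2013, Thm. 5.4 / Prop. 5.6) by gluing
the smooth representatives and the Navier–Stokes scaling
(`lerayLocalRegularH1With_of_taoH1AlmostRegularWith`). [cite: OzanskiPooley2018, Thm. 6.30, Cor. 6.16, Lemma 6.29] -/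
theorem leray_local_regular_H1_of_tao2011_H1_local_almost_regular
    (h : tao2011_H1_local_almost_regular) : leray_local_regular_H1 := by
  obtain ⟨c, hc, h⟩ := h
  exact ⟨c / 4, by positivity, lerayLocalRegularH1With_of_taoH1AlmostRegularWith hc h⟩

/-- **`tao2011_smooth_local_existence → leray_local_regular_H1`** (through the tree's proved
assembly `tao2011_H1_local_almost_regular_of_smooth_local_existence`: mollification, the
enstrophy a priori bound, `L²` stability and weak–strong uniqueness). [cite: Tao2011, Thm. 5.4 (ii)] -/
theorem leray_local_regular_H1_of_tao2011_smooth_local_existence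
    (h : tao2011_smooth_local_existence) : leray_local_regular_H1 :=
  leray_local_regular_H1_of_tao2011_H1_local_almost_regular
    (tao2011_H1_local_almost_regular_of_smooth_local_existence h)

/-- **Discharge of `leray_local_regular_H1` — Leray's local regular solutions from `H¹` data**
(Leray 1934, Acta Math. 63, Ch. III §§19–24 and (3.4); Ożański–Pooley 2018, Thm. 6.30,
Cor. 6.16, Lemma 6.29; Robinson–Rodrigo–Sadowski 2016, Thm. 6.15 with p. 99): there is an absolute
`c > 0` such that for `ν > 0`, `T > 0` and a divergence-free `u₀ ∈ H¹(ℝ³)` with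
`‖∇u₀‖⁴_{L²} T ≤ c ν³` there are `v`, `p` with `v` a Leray–Hopf weak solution on `[0, T)` from
`u₀`, `v 0 = u₀`, `‖v(t)‖²_{H¹}` finite and continuous on `[0, T]`, `(v, p)` classical on `(0, T]`,
and all Sobolev norms of `v`, `∂ₜv`, `p` bounded and all derivatives of `v` bounded on every
`[δ, T] × ℝ³`, `0 < δ ≤ T`. Proof: `leray_local_regular_H1_of_tao2011_H1_local_almost_regular`
applied to the tree's discharge `tao2011_H1_local_almost_regular_holds`
(`CheskidovShvydkoyRegularProofs.lean`: Tao's Thm. 5.4 / Prop. 5.6 for `H¹` data, through the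
Fourier-side `X¹` iteration, Plancherel for smooth `H^∞` data, mollification, the enstrophy a
priori bound and `L²` stability). [cite: Leray1934, Ch. III §§19–24 and (3.4)] [cite: OzanskiPooley2018, Thm. 6.30, Cor. 6.16, Lemma 6.29] [cite: RobinsonRodrigoSadowski2016, Thm. 6.15 and p. 99] -/
theorem leray_local_regular_H1_holds : leray_local_regular_H1 :=
  leray_local_regular_H1_of_tao2011_H1_local_almost_regular tao2011_H1_local_almost_regular_holds

end Reductions

end Literature.Analysis.FluidPDE

end
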